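import Literature.NumberTheory.EllipticCurves.BigGaloisRepSelmer
import Mathlib.RingTheory.QuotSMulTop
import HarnessLib

/-!
# Crux 4 `BSDpOnCellC` (stmt-BirchSwinnertonDyer-19034), line `telescope`, leaf N2 `stub_weightTwoControl` (W2) / N3: the LOCAL
# control defects of `M₂ = A ⊗ Λ^*(Ψ⁻¹)` at the INERTIA-type indices — `(M₂|_{I_w})^{I_w}` is the module of smooth functions valued
# in `A^{I_w}`, so «`s` kills its `(C c)`-cotorsion» (the binder `hkill` of `TelescopeK2SelmerTorsionDefect.smul_mem_map_torsionInclH1_selmer`,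
# p743708) follows from the same statement about the `p`-primary part of `A^{I_w}`; and a FINITE `(C c)`-cotorsion is killed by `C (p^a)`
# (helper, `--supports stmt-BirchSwinnertonDyer-19034 --as helper`; closes nothing)

Cell `bsd-eis`, width seat `bsd-line-x2-p2` (prover g19, 2026-08-29; D-0154 KEY row 5). THEOREMS ONLY: no definition, no named
fact, no `sorry`, no instance, no notation. Fourth file of the seat's W2-binder series (`…TelescopeK2GlobalDefectFinite` = `hglob`
and the decomposition-type `hfin`; `…GlobalDefectInputs`; `…TelescopeK2BigRepDivisible` = `hr` and the unramified inertia-type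
`hloc`). Here: the RAMIFIED inertia-type indices `w ∈ S₀`, `w ∤ p` of the strict set (the `ℤ_p`-extension `κ` is unramified at
`w`, so `κ ∘ φ = 1` along `φ : I_w → Γ_K`, but `ρ ∘ φ` is NOT trivial), where the tree's finite-defect control needs, in the shape of
p743708's `hkill`, ONE scalar `s` prime to `C c` with `s • (M₂|_{I_w})^{I_w} ⊆ (C c) • (M₂|_{I_w})^{I_w}`.

## What is proved (unconditional; binders only; general coefficient ring `𝒪`, any `φ : H → G` with `κ ∘ φ = 1`)

* §1 `mem_invariants_restrict_iff_of_trivial` — `Φ ∈ (M|_H)^H ↔ ∀ x h, ρ(φ h)(Φ x) = Φ x`: the invariants along `φ` are the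
  smooth functions VALUED IN the fixed module `A^{φ(H)}` (`(h·Φ)(x) = ρ(φ h)(Φ(x − κ(φ h))) = ρ(φ h)(Φ x)`).
* §2 **`exists_C_smul_eq_C_smul_invariants_restrict`** — THE BINDER `hkill` at `r = C c`, `s = C d`: if every `p`-primary
  `a ∈ A^{φ(H)}` has a `p`-primary `b ∈ A^{φ(H)}` with `c • b = d • a` («`d` kills the `c`-cotorsion of `A^{φ(H)}[p^∞]`»), then
  `∀ w ∈ (M|_H)^H, ∃ w' ∈ (M|_H)^H, (C c) • w' = (C d) • w` (pointwise section through the finitely many values, level kept);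
  `d = 1`: `divisibleInvariants_restrict_of_roots` (the `hloc` divisibility shape, generalising the trivial-action case).
* §3 `exists_C_pow_smul_eq_smul_of_finite_quotSMulTop` — conversely-shaped bookkeeping for ANY index: if the `(C c)`-cotorsion
  `N ⧸ (C c) • N` of a submodule `N` of `p`-primary functions is FINITE (the `hfin` shape, e.g. from
  `TelescopeK2GlobalDefectFinite.finite_quotSMulTop_invariants_restrict` at a decomposition-type index), then it is killed by
  `C (p^a)` for some `a`, i.e. `hkill` holds with `s = C (p ^ a)` — prime to `C X` in `ℤ_p⟦X⟧⟦T⟧`.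

HONEST FRAMING: elementary algebra on the constructed co-induced model over binders; which `d = p^a` works at a ramified `w ∣ N` of
the Hida branch (the (G5-w)/«constant inertia type» question of `Cruxes/BSDpOnCellC/W-PRICING-n2.md` rev 1.3) is the CONSUMER's
arithmetic input, NOT decided here; nothing about any curve, newform or branch lattice is asserted; BSD is proved for no pair; no
registered stub, crux or summit statement is proved by this file; closes: none.

References: [Castella2018Erratum] Lemma 2.1 (p. 2: the local terms `H⁰(K_v, M_g)/ϖ^m`); [JetchevSkinnerWan2017] §3.4, Lemma 3.4.1
(arXiv:1512.06894 p. 14: control with finite/bounded defect); [Ochiai2006] Prop. 5.1 (Compositio 142 p. 1177: the local terms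
`((A^{I_v})_J)^{G_v}` of `Coker(res_J)`); [Skinner2016PacificMC] §2.3, proof of Lemma 2.3.1 (p. 180: the inertia invariants of `𝓜`).
-/

noncomputable section

-- D-0017: single-problem summit, the namespace repeats the problem name by design.
set_option linter.dupNamespace false
set_option autoImplicit false

open scoped Pointwise
open Literature.NumberTheory.GaloisRepresentations Literature.NumberTheory.EllipticCurves
  Literature.NumberTheory.EllipticCurves.BigRepModule

namespace Summit.BirchSwinnertonDyer.BirchSwinnertonDyer.Theorems.TelescopeK2InertiaDefect

variable {𝒪 : Type*} [CommRing 𝒪] [TopologicalSpace 𝒪] {p : ℕ} [Fact p.Prime]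
  {A : Type*} [AddCommGroup A] [Module 𝒪 A] [TopologicalSpace A] [DiscreteTopology A]
  {G : Type*} [Group G] [TopologicalSpace G] [ContinuousMul G]
  {H : Type*} [Group H] [TopologicalSpace H]
  (κ : G →ₜ* Multiplicative ℤ_[p]) (ρ : ContinuousRep G 𝒪 A) [TopologicalSpace (PowerSeries 𝒪)]
  [ContinuousSMul (PowerSeries 𝒪) (BigRepModule 𝒪 p A)] (φ : H →ₜ* G)

/-! ## §1 Along `φ` with `κ ∘ φ = 1` the invariants are the functions valued in `A^{φ(H)}` -/

/-- **`(M|_H)^H = C^∞(ℤ_p, A^{φ(H)})`** when `κ ∘ φ = 1` (an inertia group at `w ∤ p`: the `ℤ_p`-extension is unramified at `w`):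
`Φ` is invariant iff every value is fixed by `φ(H)`. [cite: Skinner2016PacificMC, §2.3, proof of Lemma 2.3.1 (p. 180: the inertia invariants of 𝓜)]
[cite: Ochiai2006, Prop. 5.1 (the local terms (A^{I_v})_J)] -/
theorem mem_invariants_restrict_iff_of_trivial (hκ : ∀ h : H, κ (φ h) = 1) (Φ : BigRepModule 𝒪 p A) :
    Φ ∈ (((bigRep (p := p) κ ρ).restrict φ).toTopRep).ρ.invariants ↔ ∀ (x : ℤ_[p]) (h : H), ρ (φ h) (Φ x) = Φ x := by
  constructor
  · intro hΦ x h
    have := congrArg (fun Ψ : BigRepModule 𝒪 p A => Ψ x) (hΦ h)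
    change ((bigRep (p := p) κ ρ).restrict φ h Φ) x = Φ x at this
    rw [ContinuousRep.restrict_apply, bigRep_apply_apply, hκ h, toAdd_one, sub_zero] at this
    exact this
  · intro hΦ h
    ext x
    change ((bigRep (p := p) κ ρ).restrict φ h Φ) x = Φ x
    rw [ContinuousRep.restrict_apply, bigRep_apply_apply, hκ h, toAdd_one, sub_zero, hΦ x h]

/-! ## §2 The binder `hkill` at an inertia-type index from roots in `A^{φ(H)}` -/

/-- **`hkill` AT AN INERTIA-TYPE INDEX**: along `φ : H → G` with `κ ∘ φ = 1`, if every `p`-primary `φ(H)`-fixed `a ∈ A` admits a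
`p`-primary `φ(H)`-fixed `b` with `c • b = d • a` («`d` kills the `c`-cotorsion of `A^{φ(H)}[p^∞]`»; `d = p^a` when the non-cofree
part of the inertia invariants of the branch lattice is finite), then `(C d) • (M|_H)^H ⊆ (C c) • (M|_H)^H`:
`∀ w ∈ (M|_H)^H, ∃ w' ∈ (M|_H)^H, (C c) • w' = (C d) • w` — the hypothesis `hkill` of
`TelescopeK2SelmerTorsionDefect.smul_mem_map_torsionInclH1_selmer` (p743708) at `r = C c`, `s = C d`, index `v = Sum.inr w`.
[cite: Castella2018Erratum, Lemma 2.1 (p. 2)] [cite: JetchevSkinnerWan2017, Lemma 3.4.1 (arXiv:1512.06894 p. 14)]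
[cite: Ochiai2006, Prop. 5.1 (Compositio 142 p. 1177)] -/
theorem exists_C_smul_eq_C_smul_invariants_restrict (hκ : ∀ h : H, κ (φ h) = 1) (c d : 𝒪)
    (hA : ∀ a : A, (∀ h : H, ρ (φ h) a = a) → (∃ k : ℕ, p ^ k • a = 0) →
      ∃ b : A, (∀ h : H, ρ (φ h) b = b) ∧ (∃ k : ℕ, p ^ k • b = 0) ∧ c • b = d • a) :
    ∀ w ∈ (((bigRep (p := p) κ ρ).restrict φ).toTopRep).ρ.invariants,
      ∃ w' ∈ (((bigRep (p := p) κ ρ).restrict φ).toTopRep).ρ.invariants,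
        (PowerSeries.C c : PowerSeries 𝒪) • w' = (PowerSeries.C d : PowerSeries 𝒪) • w := by
  classical
  intro Φ hΦ
  rw [mem_invariants_restrict_iff_of_trivial κ ρ φ hκ] at hΦ
  obtain ⟨n, hn⟩ := Φ.exists_level
  obtain ⟨t, ht⟩ := Φ.exists_torsion
  -- a section through the values, inside the fixed `p`-primary part
  have hval : ∀ x : ℤ_[p], ∃ b : A, (∀ h : H, ρ (φ h) b = b) ∧ (∃ k : ℕ, p ^ k • b = 0) ∧ c • b = d • Φ x :=
    fun x => hA (Φ x) (fun h => hΦ x h) ⟨t, ht x⟩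
  set sec : A → A := fun a =>
    if h : ∃ b : A, (∀ h : H, ρ (φ h) b = b) ∧ (∃ k : ℕ, p ^ k • b = 0) ∧ c • b = d • a then Classical.choose h else 0
    with hsec_def
  have hsec : ∀ x : ℤ_[p], (∀ h : H, ρ (φ h) (sec (Φ x)) = sec (Φ x)) ∧ (∃ k : ℕ, p ^ k • sec (Φ x) = 0) ∧
      c • sec (Φ x) = d • Φ x := by
    intro x
    rw [hsec_def]
    simp only [dif_pos (hval x)]
    exact Classical.choose_spec (hval x)
  choose kA hkA using fun x : ℤ_[p] => (hsec x).2.1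
  let Ψ : BigRepModule 𝒪 p A := BigRepModule.mk (fun x => sec (Φ x))
    ⟨⟨n, fun x y hxy => congrArg sec (hn x y hxy)⟩, ⟨(Finset.range (p ^ n)).sup (fun i : ℕ => kA (i : ℤ_[p])), fun x => by
      have hx : Φ x = Φ ((x.appr n : ℕ) : ℤ_[p]) := hn _ _ (PadicInt.appr_spec n x)
      change p ^ _ • sec (Φ x) = 0
      rw [hx]
      have hi : x.appr n ∈ Finset.range (p ^ n) := Finset.mem_range.mpr (PadicInt.appr_lt x n)
      obtain ⟨e, he⟩ := Nat.exists_eq_add_of_le (Finset.le_sup (f := fun i : ℕ => kA (i : ℤ_[p])) hi)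
      rw [he, pow_add, mul_comm, mul_smul, hkA, smul_zero]⟩⟩
  refine ⟨Ψ, (mem_invariants_restrict_iff_of_trivial κ ρ φ hκ Ψ).2 fun x h => ?_, ?_⟩
  · change ρ (φ h) (sec (Φ x)) = sec (Φ x)
    exact (hsec x).1 h
  · rw [C_smul, C_smul]
    ext x
    change c • sec (Φ x) = (d • Φ) x
    rw [BigRepModule.smul_apply]
    exact (hsec x).2.2

/-- **`hloc` divisibility at an inertia-type index from roots in `A^{φ(H)}`** (`d = 1`): if every `p`-primary `φ(H)`-fixed `a`
has a `p`-primary `φ(H)`-fixed `c`-th root (the inertia invariants of the branch lattice are `c`-divisible: «constant inertia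
type»), then the invariants of `M|_H` are `(C c)`-divisible — the `hloc` of `TelescopeK2WeightControl.twoSided_finite_control` /
`TelescopeK2SelmerTorsionDefect.smul_mem_map_torsionInclH1_selmer_of_divisible_off` at `r = C c`.
[cite: Skinner2016PacificMC, §2.3, proof of Lemma 2.3.1 (p. 180)] [cite: Castella2018Erratum, Lemma 2.1 (p. 2)] -/
theorem divisibleInvariants_restrict_of_roots (hκ : ∀ h : H, κ (φ h) = 1) (c : 𝒪)
    (hA : ∀ a : A, (∀ h : H, ρ (φ h) a = a) → (∃ k : ℕ, p ^ k • a = 0) →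
      ∃ b : A, (∀ h : H, ρ (φ h) b = b) ∧ (∃ k : ℕ, p ^ k • b = 0) ∧ c • b = a) :
    ∀ w ∈ (((bigRep (p := p) κ ρ).restrict φ).toTopRep).ρ.invariants,
      ∃ w' ∈ (((bigRep (p := p) κ ρ).restrict φ).toTopRep).ρ.invariants, (PowerSeries.C c : PowerSeries 𝒪) • w' = w := by
  intro w hw
  obtain ⟨w', hw', h⟩ := exists_C_smul_eq_C_smul_invariants_restrict κ ρ φ hκ c 1
    (fun a ha hk => by simpa only [one_smul] using hA a ha hk) w hw
  exact ⟨w', hw', by rw [h, map_one, one_smul]⟩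

/-! ## §3 A FINITE `(C c)`-cotorsion is killed by `C (p^a)` (from `hfin` to `hkill`) -/

omit [TopologicalSpace 𝒪] [TopologicalSpace A] [DiscreteTopology A] [TopologicalSpace (PowerSeries 𝒪)]
  [ContinuousSMul (PowerSeries 𝒪) (BigRepModule 𝒪 p A)] in
/-- Every element of a `PowerSeries 𝒪`-submodule of `A ⊗ Λ^*` is killed by some `C (p^k)` (the values are `p`-primary).
[cite: SkinnerUrban2014, §3.1.3 (Λ^* is p-primary)] -/
theorem exists_C_pow_smul_eq_zero (N : Submodule (PowerSeries 𝒪) (BigRepModule 𝒪 p A)) (Φ : N) :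
    ∃ k : ℕ, (PowerSeries.C ((p : 𝒪) ^ k) : PowerSeries 𝒪) • Φ = 0 := by
  obtain ⟨k, hk⟩ := (Φ : BigRepModule 𝒪 p A).exists_torsion
  refine ⟨k, Subtype.ext ?_⟩
  rw [Submodule.coe_smul, Submodule.coe_zero, C_smul]
  ext x
  rw [BigRepModule.smul_apply, BigRepModule.zero_apply, ← Nat.cast_pow, Nat.cast_smul_eq_nsmul]
  exact hk x

omit [TopologicalSpace 𝒪] [TopologicalSpace A] [DiscreteTopology A] [TopologicalSpace (PowerSeries 𝒪)]
  [ContinuousSMul (PowerSeries 𝒪) (BigRepModule 𝒪 p A)] in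
/-- **From `hfin` to `hkill`**: if the `(C c)`-cotorsion `N ⧸ (C c) • N` of a submodule `N ⊆ A ⊗ Λ^*` is FINITE, then ONE power
`C (p^a)` kills it: `∀ w ∈ N, ∃ w' ∈ N, (C c) • w' = C (p^a) • w` — `hkill` with `s = C (p^a)` (prime to `C X` in `ℤ_p⟦X⟧⟦T⟧`),
e.g. for `N = (M|_{G_v})^{G_v}` at a decomposition-type index where `TelescopeK2GlobalDefectFinite.finite_quotSMulTop_invariants_restrict`
gives finiteness. [cite: JetchevSkinnerWan2017, Lemma 3.4.1 (arXiv:1512.06894 p. 14)] [cite: Castella2018Erratum, Lemma 2.1 (p. 2)] -/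
theorem exists_C_pow_smul_mem_of_finite_quotSMulTop (N : Submodule (PowerSeries 𝒪) (BigRepModule 𝒪 p A)) (c : 𝒪)
    [hfin : Finite (QuotSMulTop (PowerSeries.C c : PowerSeries 𝒪) N)] :
    ∃ a : ℕ, ∀ w ∈ N, ∃ w' ∈ N, (PowerSeries.C c : PowerSeries 𝒪) • w' = (PowerSeries.C ((p : 𝒪) ^ a) : PowerSeries 𝒪) • w := by
  classical
  haveI : Fintype (QuotSMulTop (PowerSeries.C c : PowerSeries 𝒪) N) := Fintype.ofFinite _
  -- one exponent killing every class: the classes are `p`-primary (lift, `exists_C_pow_smul_eq_zero`, project)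
  have hcl : ∀ q : QuotSMulTop (PowerSeries.C c : PowerSeries 𝒪) N, ∃ k : ℕ,
      (PowerSeries.C ((p : 𝒪) ^ k) : PowerSeries 𝒪) • q = 0 := by
    intro q
    obtain ⟨Φ, rfl⟩ := Submodule.Quotient.mk_surjective (p := (PowerSeries.C c : PowerSeries 𝒪) • (⊤ : Submodule (PowerSeries 𝒪) N)) q
    obtain ⟨k, hk⟩ := exists_C_pow_smul_eq_zero N Φ
    exact ⟨k, by rw [← Submodule.Quotient.mk_smul, hk, Submodule.Quotient.mk_zero]⟩
  choose kq hkq using hcl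
  refine ⟨Finset.univ.sup kq, fun w hw => ?_⟩
  -- `C (p^a) • w ∈ (C c) • N`
  have hzero : (PowerSeries.C ((p : 𝒪) ^ Finset.univ.sup kq) : PowerSeries 𝒪) •
      (Submodule.Quotient.mk (p := (PowerSeries.C c : PowerSeries 𝒪) • (⊤ : Submodule (PowerSeries 𝒪) N)) (⟨w, hw⟩ : N)) = 0 := by
    set q := Submodule.Quotient.mk (p := (PowerSeries.C c : PowerSeries 𝒪) • (⊤ : Submodule (PowerSeries 𝒪) N)) (⟨w, hw⟩ : N)
    obtain ⟨e, he⟩ := Nat.exists_eq_add_of_le (Finset.le_sup (f := kq) (Finset.mem_univ q))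
    rw [he, pow_add, map_mul, mul_comm, mul_smul, hkq, smul_zero]
  rw [← Submodule.Quotient.mk_smul, Submodule.Quotient.mk_eq_zero, Submodule.mem_smul_pointwise_iff_exists] at hzero
  obtain ⟨w', -, hw'⟩ := hzero
  refine ⟨(w' : BigRepModule 𝒪 p A), w'.2, ?_⟩
  have := congrArg (fun z : N => (z : BigRepModule 𝒪 p A)) hw'
  simpa only [Submodule.coe_smul] using this

end Summit.BirchSwinnertonDyer.BirchSwinnertonDyer.Theorems.TelescopeK2InertiaDefect

end
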